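import Summits.CriticalPhenomena.CardyFormulaZ2.Theorems.CardyBoundaryCoulombGasRectilinearCardyStubBoundaryFeetPart4
import HarnessLib

/-!
# Stub `stub_boundaryFeet` of line `excursion-kernel-covariance` — Part 5:
# signed positions of the chain darts; frame algebra (crux `RectilinearCardy`,
# stmt-CriticalPhenomena-5660)

* `bftSposZ` — the SIGNED POSITION (along the local frontier, measured from the apex of the
  wedge) of the foot of the `ι`-th chain dart of a lattice sector of type `m` with thresholds
  `X = bftX m δ re`, `Y = ⌈im/δ⌉`: non-decreasing in `ι`, consecutive values at most `2 δ` apart,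
  values two apart at least `δ` apart (`bft_sposZ_step`, `bft_sposZ_two`, `bft_sposZ_mono`);
* frame algebra for mesh segments (`bft_dirC_frame`, `bft_mesh_frame_sub`, `bft_seg_in_disc`).
All [folklore].
-/

noncomputable section

open Set Filter Metric Topology
open Literature.Probability.RandomPlanarGeometry
open Literature.Probability.LatticeModels Literature.Probability.LatticeModels.CollarLegModel
open Summit.CriticalPhenomena.CardyFormulaZ2.Cruxes.BoundaryDefectGaussianR.RainbowMonomialsInExcursionKernels

namespace Summit.CriticalPhenomena.CardyFormulaZ2.Cruxes.RectilinearCardy.ExcursionKernelCovariance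

/-! ### Signed positions of the chain darts -/

/-- The signed position (along the local frontier, measured from the apex) of the foot of the
`ι`-th chain dart. [folklore] -/
def bftSposZ (m : ℕ) (δ Pre Pim : ℝ) (X Y ι : ℤ) : ℝ :=
  if m = 2 ∨ 0 ≤ ι then δ * ((X + (if m = 3 then 1 else 0) + ι : ℤ) : ℝ) - Pre
  else if m = 3 then δ * ((Y + ι : ℤ) : ℝ) - Pim else -(δ * ((Y - 1 - ι : ℤ) : ℝ) - Pim)

/-- Rounding to the lattice: `0 ≤ δ ⌈x/δ⌉ - x < δ` and `0 ≤ x - δ ⌊x/δ⌋ < δ`. [folklore] -/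
theorem bft_round {δ : ℝ} (hδ : 0 < δ) (x : ℝ) :
    0 ≤ δ * ⌈x / δ⌉ - x ∧ δ * ⌈x / δ⌉ - x < δ ∧ 0 ≤ x - δ * ⌊x / δ⌋ ∧ x - δ * ⌊x / δ⌋ < δ := by
  have h1 : x / δ ≤ ⌈x / δ⌉ := Int.le_ceil _
  have h2 : (⌈x / δ⌉ : ℝ) < x / δ + 1 := Int.ceil_lt_add_one _
  have h3 : (⌊x / δ⌋ : ℝ) ≤ x / δ := Int.floor_le _
  have h4 : x / δ < ⌊x / δ⌋ + 1 := Int.lt_floor_add_one _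
  have e : δ * (x / δ) = x := mul_div_cancel₀ x hδ.ne'
  refine ⟨?_, ?_, ?_, ?_⟩
  · have := mul_le_mul_of_nonneg_left h1 hδ.le; linarith
  · have := mul_lt_mul_of_pos_left h2 hδ; linarith
  · have := mul_le_mul_of_nonneg_left h3 hδ.le; linarith
  · have := mul_lt_mul_of_pos_left h4 hδ; linarith

/-- **One step of the chain moves the signed position forward by at most `2 δ`.** [folklore] -/
theorem bft_sposZ_step {m : ℕ} (hm : m = 1 ∨ m = 2 ∨ m = 3) {δ : ℝ} (hδ : 0 < δ) (Pre Pim : ℝ)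
    (ι : ℤ) :
    0 ≤ bftSposZ m δ Pre Pim (bftX m δ Pre) ⌈Pim / δ⌉ (ι + 1) - bftSposZ m δ Pre Pim (bftX m δ Pre) ⌈Pim / δ⌉ ι ∧
    bftSposZ m δ Pre Pim (bftX m δ Pre) ⌈Pim / δ⌉ (ι + 1) - bftSposZ m δ Pre Pim (bftX m δ Pre) ⌈Pim / δ⌉ ι ≤ 2 * δ := by
  obtain ⟨c1, c2, f1, f2⟩ := bft_round hδ Pre
  obtain ⟨d1, d2, -, -⟩ := bft_round hδ Pim
  simp only [bftSposZ, bftX]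
  push_cast
  rcases hm with rfl | rfl | rfl
  · simp only [show ¬ ((1 : ℕ) = 3) by norm_num, if_false, show ¬ ((1 : ℕ) = 2) by norm_num,
      false_or]
    by_cases h0 : 0 ≤ ι
    · rw [if_pos h0, if_pos (by omega)]; constructor <;> nlinarith
    · by_cases h1 : ι = -1
      · subst h1; norm_num; constructor <;> nlinarith
      · rw [if_neg h0, if_neg (by omega)]; constructor <;> nlinarith
  · simp only [true_or, if_true, show ¬ ((2 : ℕ) = 3) by norm_num, if_false]
    constructor <;> nlinarith
  · simp only [if_true, show ¬ ((3 : ℕ) = 2) by norm_num, false_or]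
    by_cases h0 : 0 ≤ ι
    · rw [if_pos h0, if_pos (by omega)]; constructor <;> nlinarith
    · by_cases h1 : ι = -1
      · subst h1; norm_num; constructor <;> nlinarith
      · rw [if_neg h0, if_neg (by omega)]; constructor <;> nlinarith

/-- **Two steps of the chain move the signed position forward by at least `δ`.** [folklore] -/
theorem bft_sposZ_two {m : ℕ} (hm : m = 1 ∨ m = 2 ∨ m = 3) {δ : ℝ} (hδ : 0 < δ) (Pre Pim : ℝ)
    (ι : ℤ) :
    δ ≤ bftSposZ m δ Pre Pim (bftX m δ Pre) ⌈Pim / δ⌉ (ι + 2) - bftSposZ m δ Pre Pim (bftX m δ Pre) ⌈Pim / δ⌉ ι := by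
  obtain ⟨c1, c2, f1, f2⟩ := bft_round hδ Pre
  obtain ⟨d1, d2, -, -⟩ := bft_round hδ Pim
  simp only [bftSposZ, bftX]
  push_cast
  rcases hm with rfl | rfl | rfl
  · simp only [show ¬ ((1 : ℕ) = 3) by norm_num, if_false, show ¬ ((1 : ℕ) = 2) by norm_num,
      false_or]
    by_cases h0 : 0 ≤ ι
    · rw [if_pos h0, if_pos (by omega)]; nlinarith
    · by_cases h1 : ι = -1
      · subst h1; norm_num; nlinarith
      · by_cases h2 : ι = -2
        · subst h2; norm_num; nlinarith
        · rw [if_neg h0, if_neg (by omega)]; nlinarith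
  · simp only [true_or, if_true, show ¬ ((2 : ℕ) = 3) by norm_num, if_false]
    nlinarith
  · simp only [if_true, show ¬ ((3 : ℕ) = 2) by norm_num, false_or]
    by_cases h0 : 0 ≤ ι
    · rw [if_pos h0, if_pos (by omega)]; nlinarith
    · by_cases h1 : ι = -1
      · subst h1; norm_num; nlinarith
      · by_cases h2 : ι = -2
        · subst h2; norm_num; nlinarith
        · rw [if_neg h0, if_neg (by omega)]; nlinarith

/-- **Monotonicity of the signed positions along the chain.** [folklore] -/
theorem bft_sposZ_mono {m : ℕ} (hm : m = 1 ∨ m = 2 ∨ m = 3) {δ : ℝ} (hδ : 0 < δ) (Pre Pim : ℝ)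
    {ι κ : ℤ} (h : ι ≤ κ) :
    bftSposZ m δ Pre Pim (bftX m δ Pre) ⌈Pim / δ⌉ ι ≤ bftSposZ m δ Pre Pim (bftX m δ Pre) ⌈Pim / δ⌉ κ ∧
    (ι + 2 ≤ κ → bftSposZ m δ Pre Pim (bftX m δ Pre) ⌈Pim / δ⌉ ι + δ ≤
      bftSposZ m δ Pre Pim (bftX m δ Pre) ⌈Pim / δ⌉ κ) := by
  have hmono : ∀ (ι : ℤ) (n : ℕ), bftSposZ m δ Pre Pim (bftX m δ Pre) ⌈Pim / δ⌉ ι ≤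
      bftSposZ m δ Pre Pim (bftX m δ Pre) ⌈Pim / δ⌉ (ι + n) := by
    intro ι n
    induction n with
    | zero => simp
    | succ n ih =>
      have := (bft_sposZ_step hm hδ Pre Pim (ι + n)).1
      rw [show ι + ((n + 1 : ℕ) : ℤ) = ι + n + 1 by push_cast; ring]
      linarith
  refine ⟨?_, fun h2 => ?_⟩
  · have := hmono ι (κ - ι).toNat
    rwa [Int.toNat_of_nonneg (by omega), add_sub_cancel] at this
  · have h3 := bft_sposZ_two hm hδ Pre Pim ι
    have h4 := hmono (ι + 2) (κ - ι - 2).toNat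
    rw [Int.toNat_of_nonneg (by omega), show ι + 2 + (κ - ι - 2) = κ by ring] at h4
    linarith

/-! ### Frame algebra -/

/-- The complex lattice direction `dir (K + j)` read in the frame `K` is `i^j`. [folklore] -/
theorem bft_dirC_frame (K j : Fin 4) :
    bftDirC (K + j) * (-Complex.I) ^ (K : ℕ) = Complex.I ^ (j : ℕ) := by
  fin_cases K <;> fin_cases j <;> simp [bftDirC, tp_dir_val, pow_succ]

/-- Frame coordinates of a mesh point relative to `p`. [folklore] -/
theorem bft_mesh_frame_sub (K : Fin 4) (δ : ℝ) (v : ℤ × ℤ) (p : ℂ) :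
    ((bftMesh δ v - p) * (-Complex.I) ^ (K : ℕ)).re =
      δ * ((v.1 * (dir K).1 + v.2 * (dir K).2 : ℤ) : ℝ) - (p * (-Complex.I) ^ (K : ℕ)).re ∧
    ((bftMesh δ v - p) * (-Complex.I) ^ (K : ℕ)).im =
      δ * ((v.1 * (dir (K + 1)).1 + v.2 * (dir (K + 1)).2 : ℤ) : ℝ) - (p * (-Complex.I) ^ (K : ℕ)).im := by
  have h := tp_mesh_frame K δ v
  rw [sub_mul, Complex.sub_re, Complex.sub_im, bftMesh, h.1, h.2]
  exact ⟨rfl, rfl⟩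

/-- A point of a dart segment lies in the chart disc. [folklore] -/
theorem bft_seg_in_disc {δ : ℝ} (v : ℤ × ℤ) (k : Fin 4) {p : ℂ} {r s : ℝ} (hs : s ∈ Icc (0 : ℝ) δ)
    (hv : ∀ z, dist z (bftMesh δ v) ≤ δ → dist z p < r) :
    dist (bftMesh δ v + (s : ℂ) * bftDirC k) p < r := by
  have h1 : dist (bftMesh δ v + (s : ℂ) * bftDirC k) (bftMesh δ v) = s := by
    have := bft_dist_on_segment δ v k s 0
    simp only [Complex.ofReal_zero, zero_mul, add_zero, sub_zero] at this
    rw [this, abs_of_nonneg hs.1]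
  exact hv _ (by rw [h1]; exact hs.2)

end Summit.CriticalPhenomena.CardyFormulaZ2.Cruxes.RectilinearCardy.ExcursionKernelCovariance

end
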